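import Summits.QuantumFields.YangMills.Theorems.AlphaInputsT3ACv3AdaptedSelR
import Summits.QuantumFields.YangMills.Theorems.AlphaInputsT3ACv3DataSchemaL
import HarnessLib

/-!
# `AlphaInputsT3ACv3DataSchemaR` — STRATEGY B for 2′, RE-CUT PART R3: THE DATA SCHEMA AND THE KNIT OVER THE **READ-LOCAL** CLASS `𝒞_R` — g2's `…DataSchemaL` VERBATIM with
# `𝒞_L ↦ 𝒞_R` — lane `pub-balaban3d`, seat alpha-2 (g3)

WHY (HOME `D6L-STATUS-alpha2-g3.md` §3–§4).  (D6L) over `𝒞_L` is refutable as typed (its `regClassC` conjunct forces global smallness, incompatible with the exact top constraint for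
charged data with non-trivial holonomy around a tube-shaped large-field region); the v3 rows read only local regularity.  Over the read-local class `𝒞_R` (`…AdaptedClassR`:
`regClassC ↦ reg68LocalSet` = exactly `h68`'s text at half the constant) everything of g2's schema goes through unchanged: §1 (D6R) `AdaptedClassNonemptyT3R` (WEAKER than (D6L):
`adaptedClassNonemptyT3R_of_T3L`), `AdaptedToT3R`, `DataRowsT3R`, `DataSchemaT3ACR`; §2 ★ `ofV3At_of_dataSchemaT3R : DataSchemaT3ACR F 𝔠 a₀ a₁ → OfV3At F 𝔠 a₀ a₁` (selector
`exists_selector_adaptedClassT3R`, rows by membership); §3 the knit `dataSchemaT3ACR_of_pinnedRows` ∕ ★ `ofV3At_of_pinnedRowsR` = lane A's PinKnit with `hD6 ↦ hD6R` and `hrows` over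
`AdaptedToT3R`.  The uncharged half of (D6R) and the record-size knit are the sibling `…CoreNonemptyR`.
HONEST FRAMING.  Kinematics∕measurable selection∕bookkeeping around DISPLAYED rows; nothing of [B10]∕[7]∕[4]'s estimates asserted; count-neutral helper toward R3 2′
(`stub_laneRecordsV3`, items 19935∕19936); registry untouched; nothing about d = 4, the continuum, or a mass gap.

References: T. Bałaban, Commun. Math. Phys. 102 (1985) 255–275 [Balaban1985UV3] (Thm 2 p.272, (40)–(42) p.266, (55) p.269, (67)–(68) p.273); CMP 102 (1985) 277–309
[Balaban1985Variational] (Thm 1 (8) p.279).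
-/

set_option autoImplicit false

noncomputable section

namespace Summit.QuantumFields.YangMills.Theorems

open MeasureTheory Set
open scoped Matrix Matrix.Norms.L2Operator
open Literature.MathematicalPhysics.QuantumFieldTheory.Balaban1983to89
open Literature.MathematicalPhysics.QuantumFieldTheory.Balaban1983to89.B10 (pFun)
open Literature.MathematicalPhysics.QuantumFieldTheory.Balaban1983to89.T3ContinuumYM3Torus
open Literature.MathematicalPhysics.QuantumFieldTheory.Balaban1983to89.T3UnitLawDensityEML (ℰp)
open Literature.MathematicalPhysics.QuantumFieldTheory.Balaban1983to89.T3UnitScaleTilt (θBal)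
open Literature.MathematicalPhysics.QuantumFieldTheory.Balaban1983to89.T3LevelShift (fieldShift)
open Literature.MathematicalPhysics.QuantumFieldTheory.Balaban1983to89.T3PrintedRegularMinimiser (regFibrePr)
open Literature.MathematicalPhysics.QuantumFieldTheory.Balaban1983to89.B10Eq38TorusDomains (plaqsIn)
open Literature.MathematicalPhysics.QuantumFieldTheory.Balaban1983to89.B10Eq42TorusConstraint (bondsIn lam42 lam42_self)
open Literature.MathematicalPhysics.QuantumFieldTheory.Balaban1985CMP102
open Literature.MathematicalPhysics.QuantumFieldTheory.Balaban1985CMP102.Setting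
open Summit.QuantumFields.Balaban3D.Carriers
open Summit.QuantumFields.Balaban3D.Proofs.Primitives
open Summit.QuantumFields.Balaban3D.Proofs.GroupModelLieC (lieC)
open Summit.QuantumFields.Balaban3D.Proofs.LiftBridge (liftCfg)
open Summit.QuantumFields.Balaban3D.Proofs.TowerAC
open Summit.QuantumFields.Balaban3D.Proofs.StandardAC
open Summit.QuantumFields.Balaban3D.Proofs.InputsAC
open Summit.QuantumFields.Balaban3D.Proofs.AlphaAC (AlphaDataAC)
open Summit.QuantumFields.YangMills.Theorems.AlphaV3AC

/-! ## §1 The displayed rows over the read-local class -/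

section Schema

variable (F : T3Family) (𝔠 : AlphaConsts F.L (suGroupModel 2).N) (γ : ℝ) (hγ : 0 < γ) (hγ1 : γ ≤ (min 𝔠.gamma0 1) ^ 2)

/-- **(D6R) NON-EMPTINESS OF THE READ-LOCAL ADAPTED CLASS** (hypothesis schema, never asserted): at every level `k ≤ K`, every admissible NON-trivial history and every datum
`W`, `𝒞_R(k, h, W)` (`AlphaInputsT3AC.adaptedClassT3R`) is non-empty — some finest-lattice configuration, (68)-regular on the boxes under the recorded plaquettes of `h`, (67)-large
there, with the (0.4) loop variables of its averages small ON THE DEPENDENCY CONES of the read bonds, and, for charged `W`, with `k`-fold average `W` on `Ω_k(h)` and regular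
intermediate averages there.  WEAKER than (D6L) (`adaptedClassNonemptyT3R_of_T3L`); its UNCHARGED half is a theorem under record sizes (sibling `…CoreNonemptyR`).
[cite: Balaban1985UV3, (42) p.266 + (67)–(68) p.273; Balaban1985Variational, Thm 1 (8) p.279] -/
def AlphaInputsT3AC.AdaptedClassNonemptyT3R (K : ℕ) : Prop :=
  ∀ (k : ℕ), k ≤ K → ∀ (h : Hist (F.P K) k),
    Hist.Admissible 𝔠.lane.carrier.M₁ (rcolOf (T3Scales F γ hγ (hγ1.trans (sq_min_one_le _ 𝔠.gamma0_pos)) K) 𝔠.lane.carrier) k h →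
    h ≠ Hist.triv (F.P K) k → ∀ (W : GaugeField (F.P K) k (Matrix.specialUnitaryGroup (Fin 2) ℂ)),
      (AlphaInputsT3AC.adaptedClassT3R F 𝔠 γ hγ hγ1 K k h W).Nonempty

/-- **ADAPTED MINIMISER DATA OVER THE READ-LOCAL CLASS**: composite-minimiser maps `U_k(·, h)` PINNED to `Ut` at `h = triv`, MEASURABLE for every `(k, h)`, and, at
every ADMISSIBLE non-trivial history of the run's levels `k ≤ K`, selecting a MINIMISER of the Wilson action over `𝒞_R(k, h, W)` whenever that class is non-empty.
Satisfied by the construction of `ofV3At_of_dataSchemaT3R`. [cite: Balaban1985UV3, (42) p.266; Balaban1985Variational, Thm 1 (8) p.279 (measurable-selection reading)] -/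
def AlphaInputsT3AC.AdaptedToT3R (K : ℕ)
    (Ut : (k : ℕ) → GaugeField (F.P K) k (Matrix.specialUnitaryGroup (Fin 2) ℂ) → GaugeField (F.P K) 0 (Matrix.specialUnitaryGroup (Fin 2) ℂ))
    (UkH : (k : ℕ) → Hist (F.P K) k → GaugeField (F.P K) k (Matrix.specialUnitaryGroup (Fin 2) ℂ) →
      GaugeField (F.P K) 0 (Matrix.specialUnitaryGroup (Fin 2) ℂ)) : Prop :=
  (∀ k, UkH k (Hist.triv (F.P K) k) = Ut k) ∧
  (∀ (k : ℕ) (h : Hist (F.P K) k), Measurable (UkH k h)) ∧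
  (∀ (k : ℕ), k ≤ K → ∀ (h : Hist (F.P K) k),
    Hist.Admissible 𝔠.lane.carrier.M₁ (rcolOf (T3Scales F γ hγ (hγ1.trans (sq_min_one_le _ 𝔠.gamma0_pos)) K) 𝔠.lane.carrier) k h →
    h ≠ Hist.triv (F.P K) k →
    ∀ (W : GaugeField (F.P K) k (Matrix.specialUnitaryGroup (Fin 2) ℂ)), (AlphaInputsT3AC.adaptedClassT3R F 𝔠 γ hγ hγ1 K k h W).Nonempty →
      UkH k h W ∈ AlphaInputsT3AC.adaptedClassT3R F 𝔠 γ hγ hγ1 K k h W ∧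
        IsMinOn (fun U : GaugeField (F.P K) 0 (Matrix.specialUnitaryGroup (Fin 2) ℂ) => wilsonAction4 U)
          (AlphaInputsT3AC.adaptedClassT3R F 𝔠 γ hγ hγ1 K k h W) (UkH k h W))

/-- **(D1)–(D4), (D7) THE DISPLAYED CLUSTER-EXPANSION DATA ROWS OVER THE READ-LOCAL CLASS** (hypothesis schema, never asserted): g0's `DataRowsT3` VERBATIM with
`AdaptedToT3 ↦ AdaptedToT3R` — for EVERY read-local adapted minimiser data there are expansion data `𝔖` and auxiliary data `𝔄` for the pinned AC inputs `XT3` with the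
displayed step data `AlphaV3AC.StepDataV3AC` at every `k < K` (windows `admWindowT3`) and the terminal `Pint_K` rows. [cite: Balaban1985UV3, Thm 2 p.272 + (41) p.266 + (55) p.269] -/
def AlphaInputsT3AC.DataRowsT3R (K : ℕ)
    (Ut : (k : ℕ) → GaugeField (F.P K) k (Matrix.specialUnitaryGroup (Fin 2) ℂ) → GaugeField (F.P K) 0 (Matrix.specialUnitaryGroup (Fin 2) ℂ)) : Prop :=
  ∀ (UkH : (k : ℕ) → Hist (F.P K) k → GaugeField (F.P K) k (Matrix.specialUnitaryGroup (Fin 2) ℂ) →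
      GaugeField (F.P K) 0 (Matrix.specialUnitaryGroup (Fin 2) ℂ))
    (hU0 : ∀ V : GaugeField (F.P K) 0 (Matrix.specialUnitaryGroup (Fin 2) ℂ), UkH 0 (Hist.triv (F.P K) 0) V = V),
    AlphaInputsT3AC.AdaptedToT3R F 𝔠 γ hγ hγ1 K Ut UkH →
    ∃ (𝔖 : ∀ k, StepSeries (T3Scales F γ hγ (hγ1.trans (sq_min_one_le _ 𝔠.gamma0_pos)) K)
        (Matrix.specialUnitaryGroup (Fin 2) ℂ) ↥(lieC (suGroupModel 2))
        (nblkOf (T3Scales F γ hγ (hγ1.trans (sq_min_one_le _ 𝔠.gamma0_pos)) K) 𝔠.lane.carrier k) k)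
      (𝔄 : AlphaDataAC (suGroupModel 2) 𝔠
        (XT3 F γ hγ (hγ1.trans (sq_min_one_le _ 𝔠.gamma0_pos)) K (fun _ => Set.univ)
          (fun k => UkH (k + 1) (Hist.triv (F.P K) (k + 1))) UkH hU0 (fun _ _ => rfl)) 𝔖),
      (∀ k, k + 1 ≤ K → StepDataV3AC (suGroupModel 2) 𝔠
        (XT3 F γ hγ (hγ1.trans (sq_min_one_le _ 𝔠.gamma0_pos)) K (fun _ => Set.univ)
          (fun k => UkH (k + 1) (Hist.triv (F.P K) (k + 1))) UkH hU0 (fun _ _ => rfl)) 𝔖 𝔄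
        (AlphaInputsT3AC.admWindowT3 F 𝔠 γ hγ hγ1 K) k) ∧
      (∀ h : Hist (F.P K) K, Measurable ((inputOfAC 𝔠.lane
        (XT3 F γ hγ (hγ1.trans (sq_min_one_le _ 𝔠.gamma0_pos)) K (fun _ => Set.univ)
          (fun k => UkH (k + 1) (Hist.triv (F.P K) (k + 1))) UkH hU0 (fun _ _ => rfl)) 𝔖).Pint K h)) ∧
      (∀ (h : Hist (F.P K) K) (U : GaugeField (F.P K) K (Matrix.specialUnitaryGroup (Fin 2) ℂ)), (inputOfAC 𝔠.lane
        (XT3 F γ hγ (hγ1.trans (sq_min_one_le _ 𝔠.gamma0_pos)) K (fun _ => Set.univ)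
          (fun k => UkH (k + 1) (Hist.triv (F.P K) (k + 1))) UkH hU0 (fun _ _ => rfl)) 𝔖).Pint K h U ≤ 𝔄.cP K)

variable {F 𝔠 γ hγ hγ1}

/-- **(D6L) ⇒ (D6R)**: the OWNER's displayed non-emptiness over the localised class implies the one over the read-local class (`𝒞_L ⊆ 𝒞_R` at admissible histories).
[cite: Balaban1985UV3, (42) p.266 + (67)–(68) p.273] -/
theorem AlphaInputsT3AC.adaptedClassNonemptyT3R_of_T3L {K : ℕ} (h6 : AlphaInputsT3AC.AdaptedClassNonemptyT3L F 𝔠 γ hγ hγ1 K) :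
    AlphaInputsT3AC.AdaptedClassNonemptyT3R F 𝔠 γ hγ hγ1 K :=
  fun k hk h hh ht W => (h6 k hk h hh ht W).mono (AlphaInputsT3AC.adaptedClassT3L_subset_adaptedClassT3R hk hh W)

end Schema

/-- **`DataSchemaT3ACR F 𝔠 a₀ a₁` — THE DISPLAYED DATA SCHEMA OF STRATEGY B OVER THE READ-LOCAL CLASS** (hypothesis schema, OPEN, never asserted): for every coupling
`γ ∈ (0, (min γ₀ 1)²]` and run `K`: (N1) the window inequality; (D6R) non-emptiness of the read-local adapted classes; and a trivial-history minimiser family `Ut` with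
(D5) [7] Thm 1's rows for which the data rows hold for every read-local adapted minimiser data.  With it `ofV3At_of_dataSchemaT3R` CONSTRUCTS `OfV3At F 𝔠 a₀ a₁`.
[cite: Balaban1985UV3, Thm 2 p.272 + (40)–(42) p.266 + (55) p.269 + (67)–(68) p.273; Balaban1985Variational, Thm 1 (8) p.279] -/
def DataSchemaT3ACR (F : T3Family) (𝔠 : AlphaConsts F.L (suGroupModel 2).N) (a₀ a₁ : ℝ) : Prop :=
  ∀ (γ : ℝ) (hγ : 0 < γ) (hγ1 : γ ≤ (min 𝔠.gamma0 1) ^ 2) (K : ℕ),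
    AlphaInputsT3AC.WindowIneqT3 F 𝔠 γ K ∧
    AlphaInputsT3AC.AdaptedClassNonemptyT3R F 𝔠 γ hγ hγ1 K ∧
    ∃ Ut : (k : ℕ) → GaugeField (F.P K) k (Matrix.specialUnitaryGroup (Fin 2) ℂ) → GaugeField (F.P K) 0 (Matrix.specialUnitaryGroup (Fin 2) ℂ),
      AlphaInputsT3AC.TrivMinimiserRowsT3 F 𝔠 γ hγ hγ1 a₀ a₁ K Ut ∧ AlphaInputsT3AC.DataRowsT3R F 𝔠 γ hγ hγ1 K Ut

/-! ## §2 The assembly: `DataSchemaT3ACR ⇒ OfV3At` -/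

section Construction

variable {F : T3Family} {𝔠 : AlphaConsts F.L (suGroupModel 2).N} {a₀ a₁ : ℝ}

/-- **★ STRATEGY B'S ASSEMBLY OVER THE READ-LOCAL CLASS: `DataSchemaT3ACR F 𝔠 a₀ a₁ → AlphaInputsT3AC.OfV3At F 𝔠 a₀ a₁`.**  As g0's `ofV3At_of_dataSchemaT3`, with
`U_k(·, h) :=` the displayed [7]-minimiser `Ut k` at `h = triv`, the measurable argmin selector over `𝒞_R(k, h, W)` (`exists_selector_adaptedClassT3R`) at ADMISSIBLE
`h ≠ triv` (`1` at non-admissible histories and beyond `K` — no row reads them); rows r2∕r3∕`hLF67`∕`h68` BY MEMBERSHIP ((D6R) non-emptiness), `hU` by measurability,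
r1 and r2∕r3 at `triv` (k ≥ 1) = (D5), r3 at `k = 0` = (N1), terminal rows = measurability + (D7).  HONEST YIELD: 2′'s ∃-package at FIXED `𝔠` modulo the DISPLAYED
schema; nothing of the cluster expansion is proved. [cite: Balaban1985UV3, Thm 2 p.272 + (40)–(42) p.266 + (67)–(68) p.273; Balaban1985Variational, Thm 1 (8) p.279] -/
theorem AlphaInputsT3AC.ofV3At_of_dataSchemaT3R (D : DataSchemaT3ACR F 𝔠 a₀ a₁) : AlphaInputsT3AC.OfV3At F 𝔠 a₀ a₁ := by
  classical
  intro γ hγ hγ1 K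
  obtain ⟨hN1, hne, Ut, hT, hD⟩ := D γ hγ hγ1 K
  obtain ⟨hUt0, hUtm, hr1, hr2t, hr3t⟩ := hT
  -- the measurable argmin selectors, level by level and admissible history by admissible history
  have hsel := fun (k : ℕ) (hk : k ≤ K) (h : Hist (F.P K) k)
      (_hh : Hist.Admissible 𝔠.lane.carrier.M₁ (rcolOf (T3Scales F γ hγ (hγ1.trans (sq_min_one_le _ 𝔠.gamma0_pos)) K) 𝔠.lane.carrier) k h) =>
    AlphaInputsT3AC.exists_selector_adaptedClassT3R (F := F) (𝔠 := 𝔠) (γ := γ) (hγ := hγ) (hγ1 := hγ1) (K := K) hk h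
  let sel : (k : ℕ) → Hist (F.P K) k → GaugeField (F.P K) k (Matrix.specialUnitaryGroup (Fin 2) ℂ) →
      GaugeField (F.P K) 0 (Matrix.specialUnitaryGroup (Fin 2) ℂ) :=
    fun k h => if hk : k ≤ K then
      (if hh : Hist.Admissible 𝔠.lane.carrier.M₁ (rcolOf (T3Scales F γ hγ (hγ1.trans (sq_min_one_le _ 𝔠.gamma0_pos)) K) 𝔠.lane.carrier) k h
        then Classical.choose (hsel k hk h hh).1 else fun _ => 1)
      else fun _ => 1
  let UkH : (k : ℕ) → Hist (F.P K) k → GaugeField (F.P K) k (Matrix.specialUnitaryGroup (Fin 2) ℂ) →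
      GaugeField (F.P K) 0 (Matrix.specialUnitaryGroup (Fin 2) ℂ) :=
    fun k h => if h = Hist.triv (F.P K) k then Ut k else sel k h
  have hpin : ∀ k, UkH k (Hist.triv (F.P K) k) = Ut k := fun k => if_pos rfl
  have hoff : ∀ (k : ℕ) (h : Hist (F.P K) k), h ≠ Hist.triv (F.P K) k → UkH k h = sel k h := fun k h hh => if_neg hh
  have hU0 : ∀ V : GaugeField (F.P K) 0 (Matrix.specialUnitaryGroup (Fin 2) ℂ), UkH 0 (Hist.triv (F.P K) 0) V = V := fun V => by
    rw [hpin]; exact hUt0 V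
  have hmeas : ∀ (k : ℕ) (h : Hist (F.P K) k), Measurable (UkH k h) := by
    intro k h
    by_cases ht : h = Hist.triv (F.P K) k
    · subst ht; rw [hpin]; exact hUtm k
    · rw [hoff k h ht]
      by_cases hk : k ≤ K
      · by_cases hh : Hist.Admissible 𝔠.lane.carrier.M₁ (rcolOf (T3Scales F γ hγ (hγ1.trans (sq_min_one_le _ 𝔠.gamma0_pos)) K) 𝔠.lane.carrier) k h
        · simp only [sel, dif_pos hk, dif_pos hh]; exact (Classical.choose_spec (hsel k hk h hh).1).1
        · simp only [sel, dif_pos hk, dif_neg hh]; exact measurable_const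
      · simp only [sel, dif_neg hk]; exact measurable_const
  have hmin : ∀ (k : ℕ), k ≤ K → ∀ (h : Hist (F.P K) k),
      Hist.Admissible 𝔠.lane.carrier.M₁ (rcolOf (T3Scales F γ hγ (hγ1.trans (sq_min_one_le _ 𝔠.gamma0_pos)) K) 𝔠.lane.carrier) k h →
      h ≠ Hist.triv (F.P K) k →
      ∀ (W : GaugeField (F.P K) k (Matrix.specialUnitaryGroup (Fin 2) ℂ)), (AlphaInputsT3AC.adaptedClassT3R F 𝔠 γ hγ hγ1 K k h W).Nonempty →
        UkH k h W ∈ AlphaInputsT3AC.adaptedClassT3R F 𝔠 γ hγ hγ1 K k h W ∧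
          IsMinOn (fun U : GaugeField (F.P K) 0 (Matrix.specialUnitaryGroup (Fin 2) ℂ) => wilsonAction4 U)
            (AlphaInputsT3AC.adaptedClassT3R F 𝔠 γ hγ hγ1 K k h W) (UkH k h W) := by
    intro k hk h hh ht W hW
    rw [hoff k h ht]
    simp only [sel, dif_pos hk, dif_pos hh]
    exact (Classical.choose_spec (hsel k hk h hh).1).2.1 W ((hsel k hk h hh).2 W hW)
  have hAd : AlphaInputsT3AC.AdaptedToT3R F 𝔠 γ hγ hγ1 K Ut UkH := ⟨hpin, hmeas, hmin⟩
  obtain ⟨𝔖, 𝔄, hsteps, hPm, hPb⟩ := hD UkH hU0 hAd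
  -- membership at non-trivial admissible histories
  have hmem : ∀ (k : ℕ), k ≤ K → ∀ (h : Hist (F.P K) k),
      Hist.Admissible 𝔠.lane.carrier.M₁ (rcolOf (T3Scales F γ hγ (hγ1.trans (sq_min_one_le _ 𝔠.gamma0_pos)) K) 𝔠.lane.carrier) k h →
      h ≠ Hist.triv (F.P K) k → ∀ (W : GaugeField (F.P K) k (Matrix.specialUnitaryGroup (Fin 2) ℂ)),
        UkH k h W ∈ AlphaInputsT3AC.adaptedClassT3R F 𝔠 γ hγ hγ1 K k h W :=
    fun k hk h hh ht W => (hmin k hk h hh ht W (hne k hk h hh ht W)).1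
  refine ⟨fun _ => Set.univ, fun k => UkH (k + 1) (Hist.triv (F.P K) (k + 1)), UkH, hU0, fun _ _ => rfl, 𝔖, 𝔄, ?_, ⟨?_, ?_, ?_⟩, ?_⟩
  · -- the v3 (α) rows: steps = DATA + hU; (67)/(68) by membership (vacuous at the trivial history)
    refine ⟨fun k hk => (hsteps k hk).toStepAlpha (fun h => hmeas k h), fun k hk h hh U => ?_, fun k hk h hh U => ?_⟩
    · by_cases ht : h = Hist.triv (F.P K) k
      · intro e he
        have he' : e ∈ Hist.disc (P := F.P K) (Hist.triv (F.P K) k) := ht ▸ he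
        rw [Hist.disc_triv] at he'
        exact absurd he' (Finset.notMem_empty e)
      · exact AlphaInputsT3AC.hLF67_of_mem_adaptedClassT3R (hmem k hk h hh ht U)
    · by_cases ht : h = Hist.triv (F.P K) k
      · intro e he
        have he' : e ∈ Hist.disc (P := F.P K) (Hist.triv (F.P K) k) := ht ▸ he
        rw [Hist.disc_triv] at he'
        exact absurd he' (Finset.notMem_empty e)
      · exact AlphaInputsT3AC.h68_of_mem_adaptedClassT3R hk (hmem k hk h hh ht U)
  · -- r1: the displayed [7] Thm 1 rows of `Ut`, pinned
    intro n hnK ε₁ ε₀ h1 h2 h3 h4 V hV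
    rw [hpin]
    exact hr1 n hnK ε₁ ε₀ h1 h2 h3 h4 V hV
  · -- r2
    intro k hk h W hc b hb
    by_cases ht : h = Hist.triv (F.P K) k
    · subst ht
      rw [hpin]
      rcases Nat.eq_zero_or_pos k with rfl | hk0
      · show Ut 0 W b = W b
        rw [hUt0]
      · exact hr2t k hk0 hk W hc b hb
    · exact AlphaInputsT3AC.constraint42_of_mem_adaptedClassT3R (hmem k hk h hc.1 ht W) hc b hb
  · -- r3
    intro k hk h W hc i hi s hs q hq
    by_cases ht : h = Hist.triv (F.P K) k
    · subst ht
      rw [hpin]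
      rcases Nat.eq_zero_or_pos k with rfl | hk0
      · obtain rfl : i = 0 := Nat.le_zero.mp hi
        obtain rfl : s = 0 := Nat.le_zero.mp hs
        rw [lam42_self] at hq
        have hlt := hc.2 q (Finset.mem_coe.mpr hq)
        have h1 : (((F.L : ℝ) ^ (0 - 0))⁻¹) ^ 2 = 1 := by simp
        rw [h1, mul_one, Nat.sub_zero]
        show GaugeGroup.dist1 (GaugeField.plaqHol (Ut 0 W) q) ≤ _
        rw [hUt0]
        have hK1 : K - 0 + 1 = K + 1 := by simp
        rw [hK1] at hlt
        exact (hlt.le).trans hN1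
      · exact hr3t k hk0 hk W hc i hi s hs q hq
    · exact AlphaInputsT3AC.regularity68Levels_of_mem_adaptedClassT3R (hmem k hk h hc.1 ht W) hc i hi s hs q hq
  · -- terminal rows
    exact ⟨fun h => hmeas K h, hPm, hPb⟩

end Construction

/-! ## §3 The knit over the read-local class (lane A's `AlphaInputsT3ACMinimiserPinKnit` with (D6R) and `DataRowsT3R`) -/

section Knit

open Literature.MathematicalPhysics.QuantumFieldTheory.Balaban1983to89.T3PrintedMinimiserExistence (Thm1GlobalMinAt)
open Literature.MathematicalPhysics.QuantumFieldTheory.Balaban1983to89.ExpMeanLog (deltaSU)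
open Literature.MathematicalPhysics.QuantumFieldTheory.Balaban1983to89.T3Thresholds (sqrt_le_exp_iff)

/-- **`DataSchemaT3ACR` FROM [7] THM 1 (displayed) + SIZE CONDITIONS + (D6R) + THE DATA ROWS FOR EVERY PINNED FAMILY** — lane A's
`AlphaInputsT3AC.dataSchemaT3AC_of_pinnedRows` verbatim over the read-local class: the trivial-history pin (`trivMinimiserRowsT3_of_thm1GlobalMinAt`) and the
window inequality (`MinimiserPin.windowIneqT3_of_le`) are lane A's theorems; only `hD6R` and `hrows` change currency. [cite: Balaban1985UV3, Thm 2 p.272 + (40)–(42) p.266 + (67)–(68) p.273; Balaban1985Variational, Thm 1 (8) p.279] -/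
theorem AlphaInputsT3AC.dataSchemaT3ACR_of_pinnedRows (F : T3Family) (𝔠 : AlphaConsts F.L (suGroupModel 2).N) {a₀ a₁ : ℝ}
    (hT : Thm1GlobalMinAt F.L a₀ a₁ 𝔠.B₃) (hwin : 𝔠.B₃ * a₁ ≤ a₀)
    (hA3 : (143 * ((((3 + 4 : ℕ) : ℝ)) ^ 2 / 4) ^ 2) * (2 * (𝔠.B₃ * a₁)) ≤ 1 / 3)
    (hA2 : 2 * (2 * (𝔠.B₃ * a₁)) ≤ 2 * deltaSU (Fin 2) / (((3 + 4) * F.L : ℕ) : ℝ) ^ 2)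
    (hB₃ : 1 ≤ 2 * 𝔠.B₃) (hC : 4 * 𝔠.B₃ * (F.L : ℝ) ^ 2 * avgWindowFactor F.L ≤ 𝔠.C68)
    (hanti : (min 𝔠.gamma0 1) ^ 2 ≤ Real.exp (2 * (1 - 𝔠.p₀)))
    (hsmall : ∀ γ : ℝ, 0 < γ → γ ≤ (min 𝔠.gamma0 1) ^ 2 →
      ∀ K k : ℕ, 2 * (F.L : ℝ) ^ 2 * avgWindowFactor F.L * θBal F.L γ 𝔠.b₀ 𝔠.p₀ (K - k + 1) ≤ a₁)
    (hD6R : ∀ (γ : ℝ) (hγ : 0 < γ) (hγ1 : γ ≤ (min 𝔠.gamma0 1) ^ 2) (K : ℕ), AlphaInputsT3AC.AdaptedClassNonemptyT3R F 𝔠 γ hγ hγ1 K)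
    (hrows : ∀ (γ : ℝ) (hγ : 0 < γ) (hγ1 : γ ≤ (min 𝔠.gamma0 1) ^ 2) (K : ℕ)
      (Ut : (k : ℕ) → GaugeField (F.P K) k (Matrix.specialUnitaryGroup (Fin 2) ℂ) → GaugeField (F.P K) 0 (Matrix.specialUnitaryGroup (Fin 2) ℂ)),
      AlphaInputsT3AC.TrivMinimiserRowsT3 F 𝔠 γ hγ hγ1 a₀ a₁ K Ut → AlphaInputsT3AC.DataRowsT3R F 𝔠 γ hγ hγ1 K Ut) :
    DataSchemaT3ACR F 𝔠 a₀ a₁ := by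
  intro γ hγ hγ1 K
  have hγ1' : γ ≤ 1 := hγ1.trans (sq_min_one_le _ 𝔠.gamma0_pos)
  have hγe : Real.sqrt γ ≤ Real.exp (1 - 𝔠.p₀) := (sqrt_le_exp_iff hγ.le).mpr (hγ1.trans hanti)
  have hL1 : 1 ≤ F.L := by have := F.hL.2; omega
  have hw0 : 0 ≤ (F.L : ℝ) ^ 2 * avgWindowFactor F.L := by
    have := avgWindowFactor_pos F
    positivity
  have hC2 : 2 * (F.L : ℝ) ^ 2 * avgWindowFactor F.L ≤ 𝔠.C68 := by nlinarith
  refine ⟨MinimiserPin.windowIneqT3_of_le F 𝔠 hγ hγ1' hγe hC2 K, hD6R γ hγ hγ1 K, ?_⟩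
  obtain ⟨Ut, hUt⟩ := AlphaInputsT3AC.trivMinimiserRowsT3_of_thm1GlobalMinAt F 𝔠 γ hγ hγ1 K hT hwin hA3 hA2 hB₃
    (fun k _ => hsmall γ hγ hγ1 K k)
    (fun k i hik hkK => MinimiserPin.C68_dom_of_le hL1 hγ hγ1' hγe 𝔠.b₀_pos 𝔠.p₀_pos.le (avgWindowFactor_pos F).le 𝔠.B₃_pos.le hC K k i hik hkK)
  exact ⟨Ut, hUt, hrows γ hγ hγ1 K Ut hUt⟩

/-- ★★ **THE v3 (α) PACKAGE FROM [7] THM 1 + SIZE CONDITIONS + (D6R) + THE DATA ROWS**, through `ofV3At_of_dataSchemaT3R` — the OWNER's DEPMAP v3 of 2′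
with the kinematic row (D6) replaced by the read-local (D6R). [cite: Balaban1985UV3, Thm 2 p.272; Balaban1985Variational, Thm 1 (8) p.279] -/
theorem AlphaInputsT3AC.ofV3At_of_pinnedRowsR (F : T3Family) (𝔠 : AlphaConsts F.L (suGroupModel 2).N) {a₀ a₁ : ℝ}
    (hT : Thm1GlobalMinAt F.L a₀ a₁ 𝔠.B₃) (hwin : 𝔠.B₃ * a₁ ≤ a₀)
    (hA3 : (143 * ((((3 + 4 : ℕ) : ℝ)) ^ 2 / 4) ^ 2) * (2 * (𝔠.B₃ * a₁)) ≤ 1 / 3)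
    (hA2 : 2 * (2 * (𝔠.B₃ * a₁)) ≤ 2 * deltaSU (Fin 2) / (((3 + 4) * F.L : ℕ) : ℝ) ^ 2)
    (hB₃ : 1 ≤ 2 * 𝔠.B₃) (hC : 4 * 𝔠.B₃ * (F.L : ℝ) ^ 2 * avgWindowFactor F.L ≤ 𝔠.C68)
    (hanti : (min 𝔠.gamma0 1) ^ 2 ≤ Real.exp (2 * (1 - 𝔠.p₀)))
    (hsmall : ∀ γ : ℝ, 0 < γ → γ ≤ (min 𝔠.gamma0 1) ^ 2 →
      ∀ K k : ℕ, 2 * (F.L : ℝ) ^ 2 * avgWindowFactor F.L * θBal F.L γ 𝔠.b₀ 𝔠.p₀ (K - k + 1) ≤ a₁)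
    (hD6R : ∀ (γ : ℝ) (hγ : 0 < γ) (hγ1 : γ ≤ (min 𝔠.gamma0 1) ^ 2) (K : ℕ), AlphaInputsT3AC.AdaptedClassNonemptyT3R F 𝔠 γ hγ hγ1 K)
    (hrows : ∀ (γ : ℝ) (hγ : 0 < γ) (hγ1 : γ ≤ (min 𝔠.gamma0 1) ^ 2) (K : ℕ)
      (Ut : (k : ℕ) → GaugeField (F.P K) k (Matrix.specialUnitaryGroup (Fin 2) ℂ) → GaugeField (F.P K) 0 (Matrix.specialUnitaryGroup (Fin 2) ℂ)),
      AlphaInputsT3AC.TrivMinimiserRowsT3 F 𝔠 γ hγ hγ1 a₀ a₁ K Ut → AlphaInputsT3AC.DataRowsT3R F 𝔠 γ hγ hγ1 K Ut) :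
    AlphaInputsT3AC.OfV3At F 𝔠 a₀ a₁ :=
  AlphaInputsT3AC.ofV3At_of_dataSchemaT3R (AlphaInputsT3AC.dataSchemaT3ACR_of_pinnedRows F 𝔠 hT hwin hA3 hA2 hB₃ hC hanti hsmall hD6R hrows)

end Knit

end Summit.QuantumFields.YangMills.Theorems

end
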